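import Summits.Ventures.GridStability.Lyapunov.PolytopeRateKit
import Summits.Ventures.GridStability.Lyapunov.StructurePreservingPolytopeRateRoa
import Summits.Ventures.GridStability.Lyapunov.WSCC9LosslessRate
import Summits.Ventures.GridStability.Lyapunov.WSCC9LosslessPolytopeCusa
import Summits.Ventures.GridStability.Lyapunov.WSCC9LosslessPolytopeRate
import HarnessLib

/-!
# GridStability/Lyapunov/WSCC9LosslessPolytopeRate30 — «SP-RATE-POLYTOPE» rider: at the Cusa polytope level
# `3/10` (90 % of the closed-form polytope level `0.3316` of «WSCC9-postB-L-SPdamp»; 5× the window level) the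
# certified rate is still `1/30 s⁻¹` with the gain `42/5`

Cell `gridfusion` (LADDER-GRIDFUSION), seat gridfusion-lyap-1 (g8). Companion of
`Lyapunov/WSCC9LosslessPolytopeRate.lean` (p562524: rate `1/28 s⁻¹` on `{V ≤ 27/100} ∩ 𝒫 ∩ leaf`). OBJECT
BY NAME: `WSCC9LffNU.data.toModel` read through `Params.ofClassical` (LABEL: «synthetic lossless VARIANT of the
printed 9-bus with the printed NON-UNIFORM damping — a PIPELINE sentence, not a 9-bus sentence»). HERE the
level is `3/10`, certified below `C_ij·vtGap(θ*_ij)` by g6's Cusa–Huygens kit (`WSCC9LosslessPolytopeCusa`,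
p540430: `33/100 < C_ij·vtGap`). At this level the binding line angle `δ_1 − δ_0` may swing from
`θ*_10 = 39.95°` up to ≈ `123.8°` (offset `8·arctan(231/1250) = 83.8°`); the endpoint certificate
(`pairChecks30`, ONE `decide`) gives the Bregman slope `m = 127/1000` and the pairing ratio `k = 18/25`
(no longer `1`: the pairing-to-Bregman ratio drops below `2` that far out), so the LINE branch
`ρ(1 + hA/m) ≤ hk` now binds at `ρ ≤ 0.03438` while the kinetic branch still allows `0.03667`: the certified
rate is `1/30 s⁻¹` (not `1/28`). RATE-VS-LEVEL CENSUS of this object (CERTIFIED rows): `3/50` (window, ★ #110)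
→ `1/28`; `27/100` (polytope, p562524) → `1/28`; `3/10` (polytope, this file) → `1/30`; VALIDATED (floats):
at `33/100` (99.5 % of the polytope level) the sector degenerates (`k ≈ 0.2`). CONTENTS: `rhoHi30`,
`pairChecks30`, `cert30`, `rate30_ok`, `gain30_ok`, **`energy_le_mul_exp_neg_polytope30`**. Exact generator:
HOME/lean/tools/lyap-1/sp-polyrate/gen_wscc9.py (level `3/10`, `k` scan). THREE COLUMNS as in the companion;
no sentence of this file says that the WSCC system or any grid is stable or well damped. No named fact;
standard axioms. [cite: Khalil2002, Theorem 4.10]; [cite: VuTuritsyn2016, §IV]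
-/

noncomputable section

open Set Filter Topology Real Finset
open Summit.Ventures.GridStability.Models
open Summit.Ventures.GridStability.Models.StructurePreserving
open Summit.Ventures.GridStability.Lyapunov.StructurePreserving (EdgeRateCert vtPolytope constraintSet
  phaseEnergy phaseField phaseEnergy_le_mul_exp_neg_vt_diam)
open Summit.Ventures.GridStability.Lyapunov.PolytopeSector (HiCheck edgeRateCert_of_ratChecks)
open Summit.Ventures.GridStability.Lyapunov.WSCC9LffNU (data data_eqData data_Cc_pos)
open Summit.Ventures.GridStability.Lyapunov.WSCC9LosslessPolytope (Ccoef_eq M_pos D_pos B_symm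
  isLossless Ccoef_pos abs_angle_lt isEquilibrium level_lt_pairGap_cusa)
open Summit.Ventures.GridStability.Lyapunov.WSCC9LosslessRate (Ccoef_nonneg edge_lower hM_ratio)
open Summit.Ventures.GridStability.Lyapunov.WSCC9LosslessPolytopeRate (ne_of_Ccoef_ne_zero diam_one
  sum_M_gen sum_D_all)
open Literature.MathematicalPhysics.PowerSystems.ClassicalModel.LosslessSystem (vtGap)

namespace Summit.Ventures.GridStability.Lyapunov.WSCC9LosslessPolytopeRate30

/-! ### The certificate data and the kernel checks -/

/-- **Endpoint offsets at level `3/10`** `ρ⁺_ij` (smallest on the `10⁻⁴` grid passing confinement AND the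
ratio check with `k = 18/25`; generator `gen_wscc9.py`). Offsets in degrees: `(0,1) 52.1°, (0,2) 42.0°,
`(1,0) 83.8°, (1,2) 41.7°, (2,0) 48.1°, (2,1) 39.0°`. -/
def rhoHi30 : Fin 3 → Fin 3 → ℚ :=
  ![![0, 1141 / 10000, 459 / 5000], ![231 / 1250, 0, 57 / 625], ![527 / 5000, 853 / 10000, 0]]

/-- **The twelve endpoint checks at level `3/10` (one `decide` over `ℚ`)**: slope `127/1000`, ratio
`18/25`. CERTIFIED column. [folklore] -/
theorem pairChecks30 : ∀ i j : Fin 3, i ≠ j →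
    HiCheck (data.sd i j) (data.cd i j) (rhoHi30 i j) (data.Cc i j) (3 / 10) (127 / 1000) (18 / 25) ∧
    HiCheck (-data.sd i j) (data.cd i j) (rhoHi30 j i) (data.Cc i j) (3 / 10) (127 / 1000) (18 / 25) := by
  decide +kernel

/-- **The per-pair endpoint certificate of `ofClassical data.toModel` at level `3/10`** (slope `127/1000`,
ratio `18/25`). CERTIFIED column. [folklore] -/
theorem cert30 : EdgeRateCert (Params.ofClassical data.toModel) data.angleOf (3 / 10) (127 / 1000) (18 / 25)
    (fun i j => (data.angleOf i - data.angleOf j) - 8 * Real.arctan (rhoHi30 j i : ℝ))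
    (fun i j => (data.angleOf i - data.angleOf j) + 8 * Real.arctan (rhoHi30 i j : ℝ)) := by
  have h := edgeRateCert_of_ratChecks (p := Params.ofClassical data.toModel) (δ₀ := data.angleOf)
    (fun i j => Ccoef_nonneg i j)
    (fun i j hij => (abs_angle_lt (ne_of_Ccoef_ne_zero hij)).le)
    data.Cc data.sd data.cd rhoHi30 (fun i j => rhoHi30 j i) (3 / 10) (127 / 1000) (18 / 25)
    (by norm_num) (by norm_num) (by norm_num)
    (fun i j _ => Ccoef_eq i j)
    (fun i j _ => (data.sd_cast data_eqData i j).symm)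
    (fun i j _ => (data.cd_cast data_eqData i j).symm)
    (fun i j hij => (pairChecks30 i j (ne_of_Ccoef_ne_zero hij)).1)
    (fun i j hij => (pairChecks30 i j (ne_of_Ccoef_ne_zero hij)).2)
  push_cast at h
  exact h

/-! ### The scalar side conditions at `ρ = 1/30` -/

/-- **The rate side conditions at `ρ = 1/30`, `h = 1/20`, `m = 127/1000`, `k = 18/25`** (kinetic branch
allows `0.03667`; the LINE branch `(1/30)(1 + (1/20)(4ΣD/β)/m) ≤ (1/20)(18/25)` binds, margin at
`0.03438` — `1/29` fails). CERTIFIED. [folklore] -/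
theorem rate30_ok :
    (1 / 30 : ℝ) * (2 + 1 / 20 * (2 * (661 / 3770 : ℝ) / (4547 / 188500))) ≤ 2 * (1 / 20) ∧
    (1 / 30 : ℝ) * (1 + 1 / 20 * (4 * ((1 : ℕ) : ℝ) * (4547 / 188500 : ℝ)
      / (161205737693 / 200000000000)) / (127 / 1000)) ≤ 1 / 20 * (18 / 25) := by
  constructor <;> norm_num

/-- **The gain side conditions at `C = 14/5`** (with `m = 127/1000`). CERTIFIED. [folklore] -/
theorem gain30_ok :
    2 + 1 / 20 * (2 * (661 / 3770 : ℝ) / (4547 / 188500)) ≤ (14 / 5 : ℝ) ∧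
    1 + 1 / 20 * (4 * ((1 : ℕ) : ℝ) * (4547 / 188500 : ℝ) / (161205737693 / 200000000000))
      / (127 / 1000) ≤ (14 / 5 : ℝ) := by
  constructor <;> norm_num

/-! ### The sentence -/

/-- **«WSCC9-postB-L-SPdamp»: the certified rate `1/30 s⁻¹` on the POLYTOPE region of level `3/10`.**
For model-1's real model `data.toModel` (3 machines, PRINTED non-uniform damping
`D_i/M_i = 1/10, 1/5, 3/10`, lossless post-B couplings): every solution `γ = (δ, ω)` on `univ` (tree
convention) whose initial state has every machine pair in Vu–Turitsyn's polytope
`|(δ_i(0) − δ_j(0)) + (θ*_i − θ*_j)| < π`, lies on the momentum leaf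
`Σ M_iω_i(0) + Σ D_iδ_i(0) = Σ D_iθ*_i`, and has classical energy `V(θ*; γ 0) ≤ 3/10` (below the Cusa
polytope level `33/100` of p540430, so the polytope and `V ≤ 3/10` persist and `γ → (θ*, 0)`) satisfies,
for all `t ≥ 0`:
`V(θ*; γ t) ≤ (42/5)·V(θ*; γ 0)·exp(−t/30)`.
LABEL: synthetic lossless VARIANT of the printed 9-bus with the printed non-uniform damping — a PIPELINE
sentence, not a 9-bus sentence; `1/30 s⁻¹` is a LOWER bound on the model's rate in that region, not a
damping figure of any grid; no sentence here says a grid is stable or well damped.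
[cite: Khalil2002, Theorem 4.10]; [cite: VuTuritsyn2016, §IV]; [cite: SauerPai1998, §7.9.3, §9] -/
theorem energy_le_mul_exp_neg_polytope30 {γ : ℝ → ClassicalSwing.State 3}
    (hγ : data.toModel.IsSolutionOn γ univ)
    (hpol : ∀ i j, data.toModel.Ccoef i j ≠ 0 →
      |((γ 0).1 i - (γ 0).1 j) + (data.angleOf i - data.angleOf j)| < π)
    (hL : ∑ i, data.toModel.M i * (γ 0).2 i + ∑ i, data.toModel.D i * (γ 0).1 i
      = ∑ i, data.toModel.D i * data.angleOf i)
    (hV : data.toModel.energy data.angleOf (γ 0) ≤ 3 / 10) {t : ℝ} (ht : 0 ≤ t) :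
    data.toModel.energy data.angleOf (γ t)
      ≤ 42 / 5 * data.toModel.energy data.angleOf (γ 0) * Real.exp (-(1 / 30) * t) := by
  set p := Params.ofClassical data.toModel with hp
  have hwf : p.WellFormed := Params.wellFormed_ofClassical data.toModel M_pos D_pos B_symm
  have hδ₀ : p.IsSyncEquilibrium data.angleOf :=
    Params.isSyncEquilibrium_ofClassical data.toModel isLossless B_symm isEquilibrium
  have hb : ∀ i j, 0 ≤ p.b i j := fun i j => Ccoef_nonneg i j
  have h0 : ∀ i j, p.b i j ≠ 0 → |data.angleOf i - data.angleOf j| < π / 2 :=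
    fun i j hij => abs_angle_lt (ne_of_Ccoef_ne_zero hij)
  have hcgap : ∀ i j, p.b i j ≠ 0 →
      (3 / 10 : ℝ) < p.b i j * vtGap (data.angleOf i - data.angleOf j) :=
    fun i j hij => lt_trans (by norm_num) (level_lt_pairGap_cusa (ne_of_Ccoef_ne_zero hij) hij)
  have hhM : ∀ i ∈ p.gen, 2 * (1 / 20 : ℝ) * p.M i ≤ p.D i := fun i _ => by
    simpa [hp] using hM_ratio i
  -- the classical solution solves the structure-preserving phase field on every `[0, T]`
  have hX : ∀ T : ℝ, ∀ s ∈ Icc 0 T, HasDerivWithinAt γ (phaseField p (γ s)) (Icc 0 T) s :=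
    fun T s _ => by
      rw [hp, ClassicalSwingRoa.phaseField_ofClassical data.toModel isLossless B_symm isEquilibrium (γ s)]
      exact (hγ s (mem_univ s)).mono (subset_univ _)
  have hE : ∀ x : ClassicalSwing.State 3,
      phaseEnergy p data.angleOf x = data.toModel.energy data.angleOf x := fun x => by
    rw [StructurePreserving.phaseEnergy_apply, hp,
      Params.ofClassical_energy data.toModel isLossless B_symm isEquilibrium x.1 x.2]
  have hy : γ 0 ∈ vtPolytope p data.angleOf ∩ constraintSet p data.angleOf ∧
      phaseEnergy p data.angleOf (γ 0) ≤ 3 / 10 := by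
    refine ⟨⟨fun i j hij => hpol i j hij, ?_, fun i hi => absurd (Finset.mem_univ i) ?_⟩, ?_⟩
    · show p.momentum (γ 0).1 (γ 0).2 = p.momentum data.angleOf 0
      simp only [hp, Params.momentum, Params.ofClassical_gen, Params.ofClassical_M,
        Params.ofClassical_D, Pi.zero_apply, mul_zero, Finset.sum_const_zero, zero_add]
      exact hL
    · simp [hp] at hi
    · rw [hE]
      exact hV
  have hρK : (1 / 30 : ℝ) * (2 + 1 / 20 * (2 * (∑ i ∈ p.gen, p.M i) / (∑ i, p.D i))) ≤ 2 * (1 / 20) := by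
    rw [hp, sum_M_gen, sum_D_all]; exact rate30_ok.1
  have hρW : (1 / 30 : ℝ) * (1 + 1 / 20 * (4 * ((1 : ℕ) : ℝ) * (∑ i, p.D i)
      / (161205737693 / 200000000000)) / (127 / 1000)) ≤ 1 / 20 * (18 / 25) := by
    rw [hp, sum_D_all]; exact rate30_ok.2
  have hCK : 2 + 1 / 20 * (2 * (∑ i ∈ p.gen, p.M i) / (∑ i, p.D i)) ≤ (14 / 5 : ℝ) := by
    rw [hp, sum_M_gen, sum_D_all]; exact gain30_ok.1
  have hCW : 1 + 1 / 20 * (4 * ((1 : ℕ) : ℝ) * (∑ i, p.D i) / (161205737693 / 200000000000))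
      / (127 / 1000) ≤ (14 / 5 : ℝ) := by
    rw [hp, sum_D_all]; exact gain30_ok.2
  have hdiam := diam_one
  have hmain := phaseEnergy_le_mul_exp_neg_vt_diam hwf (by decide) hb
    (β := 161205737693 / 200000000000) (by norm_num) edge_lower hdiam h0 hδ₀ hcgap cert30
    (by norm_num) (h := 1 / 20) (by norm_num) hhM (ρ := 1 / 30) (by norm_num) hρK hρW hCK hCW hy hX ht
  rw [hE, hE] at hmain
  have e : (3 : ℝ) * (14 / 5) = 42 / 5 := by norm_num
  rw [e] at hmain
  exact hmain

end Summit.Ventures.GridStability.Lyapunov.WSCC9LosslessPolytopeRate30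

end
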